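import Summits.PneNP.PneNP.Theorems.ConvexRankGatesConvexGateBlindExactLiftingStrictRank

/-!
# An ε-free equivalent of `ExactLifting`: anchored cone factorisations of the unshifted lift

Support file for crux `ConvexGateBlind` (stmt-PneNP-10680), line `xor-door-perfect-completeness`, stub
`stub_exactLifting` (continuation of `ConvexRankGatesConvexGateBlindExactLiftingStrictRank.lean`).

`ExactLifting` quantifies over every shift `ε > 0` of the Index-lift `lift_t(viol_F)` and asks for
`t^{φ(d)} ≤ q + r` for every `(PSD_q ⊕ ℝ^r_{≥0})`-factorisation of `lift_t(viol_F) - ε`. Here the shift is traded for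
ONE entrywise-positive rank-one term (Hrubeš 2020, Lemma 14 / Lemma 16 / Proposition 17, with the PSD part carried
along):

* `HasAnchoredFact M q r` — `M = tr(H_x Y_w) + ∑_{l ≤ r} U_{x,l} V_{l,w}` with `H, Y ⪰ 0`, `U, V ≥ 0` and the term
  `l = 0` entrywise positive (`r + 1` non-negative terms in all);
* `hasAnchoredFact_of_shift` — a cone factorisation of `M - ε` (`ε > 0`) is an anchored factorisation of `M` with the
  extra term `ε ⊗ 𝟙`; `shift_of_hasAnchoredFact` — conversely an anchored factorisation of `M` gives a cone factorisation
  of `M - ε`, `ε = (min U_{·,0})(min V_{0,·}) > 0`, with one more non-negative term;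
* `AnchoredLifting` — the ε-FREE statement: `t^{φ(d)} ≤ q + r + 1` for every anchored factorisation of the UNSHIFTED
  positive integer matrix `lift_t(viol_F)`;
* `exactLifting_iff_anchored : ExactLifting ↔ AnchoredLifting` (registered stub) — the two are equivalent (the
  exponent functions differ by one, which unboundedness absorbs; `q = r = 0` is excluded by the perfect pseudo-expectation).

So the line's open stub is, exactly, a lower bound on the ANCHORED (in the LP part: strict, `rk₊₊`) cone rank of one
explicit family of positive integer matrices whose plain non-negative rank is `≤ #F · t³`
(`coneFact_lift_viol`): the shape of Hrubeš's Open Problem 4. [Hrubeš 2020, §3.3; this file]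
-/

set_option linter.dupNamespace false -- `Summit.PneNP.PneNP.…`: summit = sub-problem (D-0017)

namespace Summit.PneNP.PneNP.Theorems.XorDoor.StrictRank

open scoped BigOperators Classical
open Finset Matrix

noncomputable section

/-! ## §1 Anchored factorisations -/

/-- An ANCHORED `(PSD_q ⊕ ℝ^{r+1}_{≥0})`-factorisation of `M`: PSD part of size `q`, `r + 1` non-negative rank-one
terms, the first of which (`l = 0`) is entrywise positive. [Hrubeš 2020, §3.3 (strict rank), PSD part added] -/
def HasAnchoredFact {α β : Type} (M : α → β → ℝ) (q r : ℕ) : Prop :=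
  ∃ (H : α → Matrix (Fin q) (Fin q) ℝ) (Y : β → Matrix (Fin q) (Fin q) ℝ)
    (U : α → Fin (r + 1) → ℝ) (V : Fin (r + 1) → β → ℝ),
    (∀ a, (H a).PosSemidef) ∧ (∀ b, (Y b).PosSemidef) ∧ (∀ a l, 0 ≤ U a l) ∧ (∀ l b, 0 ≤ V l b) ∧
    (∀ a, 0 < U a 0) ∧ (∀ b, 0 < V 0 b) ∧
    ∀ a b, M a b = (H a * Y b).trace + ∑ l, U a l * V l b

/-- **Shift ⇒ anchor.** A cone factorisation of `M - ε` with `ε > 0` is an anchored factorisation of `M`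
(prepend the positive term `ε ⊗ 𝟙`). [Hrubeš 2020, Lemma 16 (ii)⇒(i), trivial half] -/
theorem hasAnchoredFact_of_shift {α β : Type} (M : α → β → ℝ) {q r : ℕ} {ε : ℝ} (hε : 0 < ε)
    (h : HasConeFact (fun a b => M a b - ε) q r) : HasAnchoredFact M q r := by
  obtain ⟨H, Y, U, V, hH, hY, hU, hV, hM⟩ := h
  refine ⟨H, Y, fun a => Fin.cons ε (U a), fun l b => (Fin.cons (1 : ℝ) (fun j => V j b) : Fin (r + 1) → ℝ) l,
    hH, hY, ?_, ?_, ?_, ?_, ?_⟩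
  · intro a l
    refine Fin.cases ?_ (fun j => ?_) l
    · simpa using hε.le
    · simpa using hU a j
  · intro l b
    refine Fin.cases ?_ (fun j => ?_) l
    · simp
    · simpa using hV j b
  · intro a; simpa using hε
  · intro b; simp
  · intro a b
    rw [Fin.sum_univ_succ]
    simp only [Fin.cons_zero, Fin.cons_succ, mul_one]
    have := hM a b
    simp only at this
    linarith

/-- **Anchor ⇒ shift.** An anchored factorisation of `M` gives, for `ε = (min_a U_{a,0})(min_b V_{0,b}) > 0`, a cone
factorisation of `M - ε` with the same PSD part and one more non-negative term:
`U₀ ⊗ V₀ - ε 𝟙 ⊗ 𝟙 = (U₀ - min U₀) ⊗ V₀ + (min U₀) 𝟙 ⊗ (V₀ - min V₀)`. [Hrubeš 2020, Lemma 14 / Proposition 17] -/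
theorem shift_of_hasAnchoredFact {α β : Type} [Fintype α] [Fintype β] [Nonempty α] [Nonempty β]
    (M : α → β → ℝ) {q r : ℕ} (h : HasAnchoredFact M q r) :
    ∃ ε : ℝ, 0 < ε ∧ HasConeFact (fun a b => M a b - ε) q (r + 2) := by
  obtain ⟨H, Y, U, V, hH, hY, hU, hV, hU0, hV0, hM⟩ := h
  obtain ⟨x₀, -, hx₀⟩ := Finset.exists_min_image Finset.univ (fun x => U x 0) Finset.univ_nonempty
  obtain ⟨w₀, -, hw₀⟩ := Finset.exists_min_image Finset.univ (fun w => V 0 w) Finset.univ_nonempty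
  set μ : ℝ := U x₀ 0 with hμ
  set ν : ℝ := V 0 w₀ with hν
  have hμpos : 0 < μ := hU0 x₀
  have hνpos : 0 < ν := hV0 w₀
  have hμle : ∀ x, μ ≤ U x 0 := fun x => hx₀ x (Finset.mem_univ x)
  have hνle : ∀ w, ν ≤ V 0 w := fun w => hw₀ w (Finset.mem_univ w)
  refine ⟨μ * ν, mul_pos hμpos hνpos, H, Y,
    fun x => Fin.cons (U x 0 - μ) (Fin.cons μ (fun j => U x j.succ)),
    fun l w => (Fin.cons (V 0 w) (Fin.cons (V 0 w - ν) (fun j => V j.succ w)) : Fin (r + 2) → ℝ) l,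
    hH, hY, ?_, ?_, ?_⟩
  · intro x l
    refine Fin.cases ?_ (fun l' => ?_) l
    · simpa using hμle x
    · refine Fin.cases ?_ (fun j => ?_) l'
      · simpa using hμpos.le
      · simpa using hU x j.succ
  · intro l w
    refine Fin.cases ?_ (fun l' => ?_) l
    · simpa using hV 0 w
    · refine Fin.cases ?_ (fun j => ?_) l'
      · simpa using hνle w
      · simpa using hV j.succ w
  · intro x w
    show M x w - μ * ν = (H x * Y w).trace +
      ∑ l, (Fin.cons (U x 0 - μ) (Fin.cons μ (fun j => U x j.succ)) : Fin (r + 2) → ℝ) l *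
        (Fin.cons (V 0 w) (Fin.cons (V 0 w - ν) (fun j => V j.succ w)) : Fin (r + 2) → ℝ) l
    rw [hM x w, Fin.sum_univ_succ, Fin.sum_univ_succ (n := r + 1), Fin.sum_univ_succ (n := r)]
    simp only [Fin.cons_zero, Fin.cons_succ]
    ring

/-! ## §2 The ε-free form of the stub and the equivalence -/

/-- **`AnchoredLifting`** — the ε-free twin of `ExactLifting`: there is an unbounded `φ` such that for every
unsatisfiable 3-sparse `F` with a degree-`d` perfect-completeness pseudo-expectation, eventually in the gadget size
`t`, every ANCHORED cone factorisation of the unshifted lift `lift_t(viol_F)` (PSD size `q`, `r + 1` non-negative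
terms, the first entrywise positive) has `t^{φ(d)} ≤ q + r + 1`. [this file] -/
def AnchoredLifting : Prop :=
  ∃ φ : ℕ → ℕ, (∀ K : ℕ, ∃ d : ℕ, K ≤ φ d) ∧
    ∀ (m d : ℕ) (F : Finset (Pool m)),
      (¬ ∃ y : Fin m → ZMod 2, ∀ e ∈ F, Sat y e) → HasPerfectPseudoExp d F →
      ∃ T : ℕ, ∀ t : ℕ, T ≤ t → ∀ q r : ℕ,
        HasAnchoredFact (fun (x : Fin m → Fin t → ZMod 2) (w : Fin m → Fin t) =>
          (viol F (fun i => x i (w i)) : ℝ)) q r →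
        t ^ φ d ≤ q + r + 1

/-- Shifting the exponent function down by one keeps it unbounded. [folklore] -/
theorem unbounded_pred {φ : ℕ → ℕ} (hφ : ∀ K : ℕ, ∃ d : ℕ, K ≤ φ d) :
    ∀ K : ℕ, ∃ d : ℕ, K ≤ φ d - 1 := by
  intro K
  obtain ⟨d, hd⟩ := hφ (K + 1)
  exact ⟨d, by omega⟩

/-- The elementary exponent step: from `t · t^{e-1} = t^e ≤ B + 1` with `2 ≤ t` and `B + 1 ≤ 2 B'` conclude
`t^{e-1} ≤ B'`; for `e = 0` one needs `1 ≤ B'`. [folklore] -/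
theorem pow_pred_le {t e B B' : ℕ} (ht : 2 ≤ t) (h : t ^ e ≤ B) (hB : B ≤ 2 * B') (h1 : 1 ≤ B') :
    t ^ (e - 1) ≤ B' := by
  rcases Nat.eq_zero_or_pos e with rfl | he
  · simpa using h1
  · have hte : t ^ e = t * t ^ (e - 1) := by
      rw [← pow_succ']
      congr 1
      omega
    have h2 : 2 * t ^ (e - 1) ≤ t * t ^ (e - 1) := Nat.mul_le_mul_right _ ht
    omega

/-- **A perfect pseudo-expectation excludes the empty factorisation.** If `F` carries a degree-`d` perfect
pseudo-expectation and `t ≥ 1`, then `lift_t(viol_F) - ε` with `ε > 0` has no cone factorisation with `q = r = 0`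
(that would make `viol_F ≡ ε`, whence `Ẽ[viol_F] = ε Ẽ[1] = ε ≠ 0`). [this file] -/
theorem one_le_of_hasConeFact_shift {m d t : ℕ} {F : Finset (Pool m)} (hPE : HasPerfectPseudoExp d F)
    (ht : 1 ≤ t) {ε : ℝ} (hε : 0 < ε) {q r : ℕ}
    (h : HasConeFact (fun (x : Fin m → Fin t → ZMod 2) (w : Fin m → Fin t) =>
      (viol F (fun i => x i (w i)) : ℝ) - ε) q r) : 1 ≤ q + r := by
  by_contra hqr
  have hq : q = 0 := by omega
  have hr : r = 0 := by omega
  subst hq; subst hr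
  obtain ⟨H, Y, U, V, -, -, -, -, hM⟩ := h
  -- every `y` is of the form `x[w]`, so `viol_F ≡ ε`
  have hconst : ∀ y : Fin m → ZMod 2, (viol F y : ℝ) = ε := by
    intro y
    have := hM (fun i _ => y i) (fun _ => ⟨0, ht⟩)
    simp only [Matrix.trace, Finset.univ_eq_empty, Finset.sum_empty, add_zero] at this
    linarith
  obtain ⟨E, -, -, hE1, hEv⟩ := hPE
  have hfun : (fun y : Fin m → ZMod 2 => (viol F y : ℝ)) = ε • (fun _ => (1 : ℝ)) := by
    funext y; simp [hconst y]
  rw [hfun, LinearMap.map_smul, hE1, smul_eq_mul, mul_one] at hEv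
  exact hε.ne' hEv

/-- **`ExactLifting ↔ AnchoredLifting`.** The line's open stub is equivalent to its ε-free anchored form:
(→) an anchored factorisation of the lift shifts to a cone factorisation of `lift - ε` with one more term
(`shift_of_hasAnchoredFact`), so `t^{φ(d)} ≤ q + r + 2` and `t^{φ(d)-1} ≤ q + r + 1` for `t ≥ 2`;
(←) a cone factorisation of `lift - ε` is an anchored factorisation of the lift (`hasAnchoredFact_of_shift`), so
`t^{φ(d)} ≤ q + r + 1` and `t^{φ(d)-1} ≤ q + r` for `t ≥ 2`, using `q + r ≥ 1` (`one_le_of_hasConeFact_shift`).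
[this file] -/
theorem exactLifting_iff_anchored : ExactLifting ↔ AnchoredLifting := by
  constructor
  · rintro ⟨φ, hφ, h⟩
    refine ⟨fun d => φ d - 1, unbounded_pred hφ, fun m d F hunsat hPE => ?_⟩
    obtain ⟨T, hT⟩ := h m d F hunsat hPE
    refine ⟨T + 2, fun t ht q r hanch => ?_⟩
    haveI : Nonempty (Fin t) := ⟨⟨0, by omega⟩⟩
    obtain ⟨ε, hε, hcone⟩ :=
      shift_of_hasAnchoredFact (fun (x : Fin m → Fin t → ZMod 2) (w : Fin m → Fin t) =>
        (viol F (fun i => x i (w i)) : ℝ)) hanch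
    have hb : t ^ φ d ≤ q + (r + 2) := hT t ε (by omega) hε q (r + 2) (by simpa using hcone)
    exact pow_pred_le (by omega) hb (by omega) (by omega)
  · rintro ⟨φ, hφ, h⟩
    refine ⟨fun d => φ d - 1, unbounded_pred hφ, fun m d F hunsat hPE => ?_⟩
    obtain ⟨T, hT⟩ := h m d F hunsat hPE
    refine ⟨T + 2, fun t ε ht hε q r hcone => ?_⟩
    have h1 : 1 ≤ q + r := one_le_of_hasConeFact_shift hPE (by omega) hε hcone
    have hanch := hasAnchoredFact_of_shift (fun (x : Fin m → Fin t → ZMod 2) (w : Fin m → Fin t) =>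
        (viol F (fun i => x i (w i)) : ℝ)) hε hcone
    have hb : t ^ φ d ≤ q + r + 1 := hT t (by omega) q r hanch
    exact pow_pred_le (by omega) hb (by omega) h1

end

end Summit.PneNP.PneNP.Theorems.XorDoor.StrictRank
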